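import Mathlib
import Literature.Combinatorics.Additive.BorderTricoloredSumFree
import Literature.Combinatorics.Additive.TricoloredSumFreeBound
import Literature.Computability.AlgebraicComplexity.XyzFreeDiagonal
import Summits.MatrixMultiplication.MatrixMultiplication.Theorems.SoloInformedCwTwoBorderSumFree

/-!
# Door D6 is closed in hosts of bounded exponent (modulo Strassen's free-diagonal theorem)

Solo seat `solo-MatrixMultiplication-informed`, gen 9. The door
`matrixMultiplication_of_weighted_designs` (`SoloInformedCwTwoMonomialDoor.lean`) derives
`ω(ℂ) = 2` from weighted digit designs of `S_N` (the support of `X^{⊠N}`, `X` restriction-equivalent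
to `T_{cw,2}`) in finite abelian groups `B` with `|B| ≤ (3+ε)^N`. Here we prove that such designs
cannot live in groups of BOUNDED EXPONENT: for every `ℓ` there is `δ > 0` with
`3^N ≤ |B|^{1-δ}` for every design of `S_N` in a group of exponent `≤ ℓ`
(`three_pow_le_card_rpow_of_design`), hence the door's hypothesis restricted to exponent `≤ ℓ`
is false (`not_weighted_designs_of_bounded_exponent`).

The proof transfers the tricolored-sum-free (slice rank) barrier of
Blasiak–Church–Cohn–Grochow–Naslund–Sawin–Umans 2017 to the door: a design makes `S_N` a
combinatorial degeneration of its relation set, so a FREE DIAGONAL of `S_K` together with the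
design weights is a border tricolored sum-free set (`isBorderTricoloredSumFree_of_design`, BCCGNSU
Def. 3.2, tree `IsBorderTricoloredSumFree`); BCCGNSU Lemma 3.4 (tree, proved) turns it into genuine
tricolored sum-free sets in powers, and BCCGNSU Thm. A (tree, proved in qualitative form,
`exists_tricoloredSumFree_card_le`) bounds those by `3|H|^{1-δ}`. The one ingredient not in the
tree is Strassen's theorem that `S₁` (a tight set with uniform marginals) has asymptotic subrank
`3`, i.e. free diagonals of size `(3-η)^k` in `S_k` for large `k` (Strassen 1991; Christandl–
Vrana–Zuiddam 2018 Thm. 4.4); it enters as the explicit hypothesis `XyzFreeDiagonalHypothesis` (Literature fact,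
`Literature/Computability/AlgebraicComplexity/XyzFreeDiagonal.lean`). The combinatorial half
(design + free diagonal ⟹ border tricolored sum-free set) is `SoloInformedCwTwoBorderSumFree.lean`.

References: BCCGNSU 2017 (arXiv:1605.06702) Def. 3.1/3.2, Lemma 3.4, Thm. A; V. Strassen,
J. reine angew. Math. 413 (1991) 127–180; M. Christandl, P. Vrana, J. Zuiddam, arXiv:1709.07851,
Def. 4.1, Thm. 4.4.
-/

open scoped BigOperators
open Filter Topology

namespace Summit.MatrixMultiplication.MatrixMultiplication.Theorems

open Literature.Combinatorics.Additive Literature.Computability.AlgebraicComplexity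

/-! ## Two elementary limits -/

section Analysis

/-- If `x^M ≤ C (2MR+1)² y^M` for all `M`, then `x ≤ y` (exponential beats polynomial). [folklore] -/
theorem le_of_pow_le_mul_sq_mul_pow {x y C R : ℝ} (hx : 0 < x) (hy : 0 < y) (hC : 0 < C)
    (hR : 0 ≤ R) (h : ∀ M : ℕ, x ^ M ≤ C * (2 * M * R + 1) ^ 2 * y ^ M) : x ≤ y := by
  by_contra hxy
  push Not at hxy
  set r : ℝ := y / x with hr
  have hr0 : 0 ≤ r := div_nonneg hy.le hx.le
  have hr1 : r < 1 := (div_lt_one hx).2 hxy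
  have hrpos : 0 < r := div_pos hy hx
  -- normalised inequality: 1 ≤ C (2R+1)² (M+1)² r^M
  have key : ∀ M : ℕ, (1 : ℝ) ≤ C * (2 * R + 1) ^ 2 / r * (((M + 1 : ℕ) : ℝ) ^ 2 * r ^ (M + 1)) := by
    intro M
    have hM := h M
    have hxM : 0 < x ^ M := pow_pos hx M
    have h1 : y ^ M = r ^ M * x ^ M := by
      rw [hr, div_pow, div_mul_cancel₀ _ hxM.ne']
    rw [h1] at hM
    have h2 : 1 ≤ C * (2 * M * R + 1) ^ 2 * r ^ M := by
      have h1' : 1 * x ^ M ≤ (C * (2 * M * R + 1) ^ 2 * r ^ M) * x ^ M := by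
        rw [one_mul]; convert hM using 1; ring
      exact le_of_mul_le_mul_right h1' hxM
    have hM0 : (0 : ℝ) ≤ M := Nat.cast_nonneg M
    have h3 : (2 * (M : ℝ) * R + 1) ^ 2 ≤ (2 * R + 1) ^ 2 * ((M + 1 : ℕ) : ℝ) ^ 2 := by
      rw [← mul_pow]
      apply pow_le_pow_left₀ (by positivity)
      push_cast
      nlinarith
    have hr_ne : r ≠ 0 := hrpos.ne'
    calc (1 : ℝ) ≤ C * (2 * M * R + 1) ^ 2 * r ^ M := h2
      _ ≤ C * ((2 * R + 1) ^ 2 * ((M + 1 : ℕ) : ℝ) ^ 2) * r ^ M := by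
          gcongr
      _ = C * (2 * R + 1) ^ 2 / r * (((M + 1 : ℕ) : ℝ) ^ 2 * r ^ (M + 1)) := by
          field_simp
          ring
  have lim0 : Tendsto (fun n : ℕ => (n : ℝ) ^ 2 * r ^ n) atTop (𝓝 0) :=
    tendsto_pow_const_mul_const_pow_of_lt_one 2 hr0 hr1
  have lim1 : Tendsto (fun M : ℕ => (((M + 1 : ℕ) : ℝ)) ^ 2 * r ^ (M + 1)) atTop (𝓝 0) :=
    (tendsto_add_atTop_iff_nat 1).2 lim0
  have lim2 : Tendsto (fun M : ℕ => C * (2 * R + 1) ^ 2 / r * ((((M + 1 : ℕ) : ℝ)) ^ 2 * r ^ (M + 1)))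
      atTop (𝓝 0) := by
    simpa using lim1.const_mul (C * (2 * R + 1) ^ 2 / r)
  obtain ⟨M, hM⟩ := (lim2.eventually (gt_mem_nhds zero_lt_one)).exists
  exact absurd (key M) (not_le.2 hM)

/-- If `(3-η)^N ≤ c` for all `η ∈ (0,1)`, then `3^N ≤ c`. [folklore] -/
theorem three_pow_le_of_forall_sub {N : ℕ} {c : ℝ}
    (h : ∀ η : ℝ, 0 < η → η < 1 → (3 - η) ^ N ≤ c) : (3 : ℝ) ^ N ≤ c := by
  by_contra hc
  push Not at hc
  have hcont : ContinuousAt (fun η : ℝ => (3 - η) ^ N) 0 :=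
    ((continuous_const.sub continuous_id).pow N).continuousAt
  have hev : ∀ᶠ η in 𝓝 (0 : ℝ), c < (3 - η) ^ N := by
    have : c < (fun η : ℝ => (3 - η) ^ N) 0 := by simpa using hc
    exact hcont.eventually (lt_mem_nhds this)
  obtain ⟨ε, hε, hball⟩ := Metric.eventually_nhds_iff.1 hev
  have hη : dist (min (ε / 2) (1 / 2)) (0 : ℝ) < ε := by
    rw [Real.dist_eq, sub_zero, abs_of_pos (by positivity)]
    exact lt_of_le_of_lt (min_le_left _ _) (by linarith)
  have h1 := hball hη
  have h2 := h (min (ε / 2) (1 / 2)) (by positivity) (lt_of_le_of_lt (min_le_right _ _) (by norm_num))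
  exact absurd h2 (not_le.2 h1)

end Analysis

/-! ## The bounded-exponent closure -/

section Main

/-- The exponent of `B^{M'}`-valued functions on `Fin M` divides that of `B`. [folklore] -/
theorem exponent_fun_fun_le {B : Type*} [AddCommGroup B] [Finite B] (M M' : ℕ) :
    AddMonoid.exponent (Fin M → Fin M' → B) ≤ AddMonoid.exponent B := by
  have hpos : 0 < AddMonoid.exponent B :=
    AddMonoid.exponent_pos.2 AddMonoid.ExponentExists.of_finite
  refine Nat.le_of_dvd hpos (AddMonoid.exponent_dvd_of_forall_nsmul_eq_zero fun g => ?_)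
  funext i j
  simp [AddMonoid.exponent_nsmul_eq_zero]

/-- **Door D6 is closed in bounded exponent** (modulo Strassen's free-diagonal theorem): for every
`ℓ` there is `δ > 0` such that every weighted digit design of `S_N` in a finite abelian group `B`
of exponent `≤ ℓ` has `3^N ≤ |B|^{1-δ}` — so its rate `|B|^{1/N}` is at least `3^{1/(1-δ)} > 3`.
Ingredients: `isBorderTricoloredSumFree_of_design`, BCCGNSU Lemma 3.4 and Thm. A (tree), and the
hypothesis `XyzFreeDiagonalHypothesis` (Strassen 1991).
[cite: BlasiakChurchCohnGrochowNaslundSawinUmans2017, Thm. A and Lemma 3.4] -/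
theorem three_pow_le_card_rpow_of_design (hStr : XyzFreeDiagonalHypothesis) (ℓ : ℕ) :
    ∃ δ : ℝ, 0 < δ ∧ ∀ (N : ℕ) (B : Type) [AddCommGroup B] [Fintype B]
      (f : Fin N → Fin 3 → B) (a : Fin N → Fin 3 → ℕ),
      AddMonoid.exponent B ≤ ℓ → IsDoorDesign f a →
        (3 : ℝ) ^ N ≤ (Fintype.card B : ℝ) ^ (1 - δ) := by
  classical
  obtain ⟨δ, hδ, hA⟩ : ∃ δ : ℝ, 0 < δ ∧ ∀ (H : Type) [AddCommGroup H] [Fintype H],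
      AddMonoid.exponent H ≤ ℓ → ∀ (ι : Type) [Fintype ι] (s t u : ι → H),
        IsTricoloredSumFree s t u → (Fintype.card ι : ℝ) ≤ 3 * (Fintype.card H : ℝ) ^ (1 - δ) :=
    exists_tricoloredSumFree_card_le ℓ
  refine ⟨min δ (1 / 2), lt_min hδ (by norm_num), fun N B _ _ f a hexp hdes => ?_⟩
  have hcard1 : (1 : ℝ) ≤ Fintype.card B := by exact_mod_cast Fintype.card_pos (α := B)
  have hcB0 : (0 : ℝ) ≤ Fintype.card B := by positivity
  rcases Nat.eq_zero_or_pos N with rfl | hN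
  · rw [pow_zero]
    exact Real.one_le_rpow hcard1 (by linarith [min_le_right δ (1 / 2)])
  -- it suffices to prove the bound with `δ` itself
  suffices hmain : (3 : ℝ) ^ N ≤ (Fintype.card B : ℝ) ^ (1 - δ) by
    exact hmain.trans (Real.rpow_le_rpow_of_exponent_le hcard1 (by
      linarith [min_le_left δ (1 / 2)]))
  -- N ≥ 1: the main argument, for every η ∈ (0,1)
  refine three_pow_le_of_forall_sub fun η hη hη1 => ?_
  obtain ⟨k₀, hk₀⟩ := hStr η hη hη1
  set M' : ℕ := k₀ + 1 with hM'
  have hM'pos : 0 < M' := Nat.succ_pos _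
  have hK : k₀ ≤ Fintype.card (Fin M' × Fin N) := by
    rw [Fintype.card_prod, Fintype.card_fin, Fintype.card_fin, hM']
    nlinarith
  obtain ⟨D, hD1, hD2, hDcard⟩ := hk₀ (Fin M' × Fin N) hK
  have hD : IsXyzFreeDiagonal D := ⟨hD1, hD2⟩
  rw [Fintype.card_prod, Fintype.card_fin, Fintype.card_fin] at hDcard
  -- the border tricolored sum-free set and its weight bound
  have hB := isBorderTricoloredSumFree_of_design (M' := M') hdes hD
  set W₀ : ℕ := ∑ k, (a k 0 + a k 1 + a k 2) with hW₀
  set R : ℕ := 4 * M' * W₀ with hR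
  have hRb : ∀ x : D, |3 * (blockWt a x.1.1 : ℤ) - M' * (W₀ : ℕ)| ≤ R ∧
      |3 * (blockWt a x.1.2.1 : ℤ) - M' * (W₀ : ℕ)| ≤ R :=
    fun x => ⟨abs_blockWt_weight_le a _, abs_blockWt_weight_le a _⟩
  -- for every M: Lemma 3.4 then Thm. A in (Fin M → Fin M' → B)
  have hineq : ∀ M : ℕ, ((D.card : ℝ)) ^ M ≤
      3 * (2 * M * R + 1) ^ 2 * (((Fintype.card B : ℝ) ^ (1 - δ)) ^ M') ^ M := by
    intro M
    obtain ⟨Mset, hT, hcnt⟩ := hB.exists_isTricoloredSumFree_pi R hRb M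
    have hexp' : AddMonoid.exponent (Fin M → Fin M' → B) ≤ ℓ :=
      (exponent_fun_fun_le M M').trans hexp
    have hA' := hA (Fin M → Fin M' → B) hexp' _ _ _ _ hT
    have hcardH : (Fintype.card (Fin M → Fin M' → B) : ℝ) =
        ((Fintype.card B : ℝ) ^ M') ^ M := by
      rw [Fintype.card_fun, Fintype.card_fun, Fintype.card_fin, Fintype.card_fin]
      push_cast; ring
    rw [hcardH, ← Real.rpow_pow_comm (pow_nonneg hcB0 M') (1 - δ) M,
      ← Real.rpow_pow_comm hcB0 (1 - δ) M'] at hA'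
    have hcnt' : ((D.card : ℝ)) ^ M ≤ (2 * M * R + 1) ^ 2 * (Mset.card : ℝ) := by
      have : (Fintype.card D : ℝ) ^ M ≤ ((2 * M * R + 1) ^ 2 * Mset.card : ℕ) := by
        exact_mod_cast hcnt
      rw [Fintype.card_coe] at this
      push_cast at this
      exact this
    have hMset : (Mset.card : ℝ) = Fintype.card Mset := by rw [Fintype.card_coe]
    calc ((D.card : ℝ)) ^ M ≤ (2 * M * R + 1) ^ 2 * (Mset.card : ℝ) := hcnt'
      _ ≤ (2 * M * R + 1) ^ 2 * (3 * (((Fintype.card B : ℝ) ^ (1 - δ)) ^ M') ^ M) := by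
          rw [hMset]; gcongr
      _ = 3 * (2 * M * R + 1) ^ 2 * (((Fintype.card B : ℝ) ^ (1 - δ)) ^ M') ^ M := by ring
  -- exponential vs polynomial: |D| ≤ (|B|^{1-δ})^{M'}
  have hDpos : (0 : ℝ) < D.card := lt_of_lt_of_le (by
    have : (0:ℝ) < 3 - η := by linarith
    positivity) hDcard
  have hy : (0 : ℝ) < ((Fintype.card B : ℝ) ^ (1 - δ)) ^ M' := by positivity
  have hle := le_of_pow_le_mul_sq_mul_pow hDpos hy (by norm_num : (0:ℝ) < 3)
    (by positivity : (0:ℝ) ≤ R) hineq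
  -- take M'-th roots
  have h3η : (0 : ℝ) ≤ 3 - η := by linarith
  have hpow : ((3 - η) ^ N) ^ M' ≤ ((Fintype.card B : ℝ) ^ (1 - δ)) ^ M' :=
    calc ((3 - η) ^ N) ^ M' = (3 - η) ^ (M' * N) := by rw [← pow_mul, Nat.mul_comm]
      _ ≤ D.card := hDcard
      _ ≤ _ := hle
  exact (pow_le_pow_iff_left₀ (pow_nonneg h3η N) (by positivity) hM'pos.ne').1 hpow

/-- **The door's hypothesis fails in bounded exponent** (modulo Strassen's free-diagonal theorem):
for no `ℓ` can the weighted designs of `matrixMultiplication_of_weighted_designs` — one for every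
`ε > 0`, with `|B| ≤ (3+ε)^N` — all be found in groups of exponent `≤ ℓ`. The design clause is the
door's, verbatim. [cite: BlasiakChurchCohnGrochowNaslundSawinUmans2017, Thm. A] -/
theorem not_weighted_designs_of_bounded_exponent (hStr : XyzFreeDiagonalHypothesis) (ℓ : ℕ) :
    ¬ ∀ ε : ℝ, 0 < ε → ∃ (N : ℕ) (B : Type) (_ : AddCommGroup B) (_ : Fintype B)
      (_ : DecidableEq B) (f : Fin N → Fin 3 → B) (a : Fin N → Fin 3 → ℕ), 0 < N ∧
      AddMonoid.exponent B ≤ ℓ ∧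
      (∀ u v w : Fin N → Fin 3,
        wordSum f u + wordSum f v + wordSum f w = ∑ k, (f k 0 + f k 1 + f k 2) →
          (∀ k, u k ≠ v k ∧ u k ≠ w k ∧ v k ≠ w k) ∨
            ∑ k, (a k 0 + a k 1 + a k 2) < wordWt a u + wordWt a v + wordWt a w) ∧
      (Fintype.card B : ℝ) ≤ (3 + ε) ^ N := by
  intro h
  obtain ⟨δ, hδ, hmain⟩ := three_pow_le_card_rpow_of_design hStr ℓ
  by_cases hd : δ ≤ 1
  · -- choose ε with (3+ε)^{1-δ} < 3
    have hd' : 0 ≤ 1 - δ := by linarith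
    have h30 : (3 : ℝ) ^ (1 - δ) < 3 := by
      have := Real.rpow_lt_rpow_of_exponent_lt (by norm_num : (1 : ℝ) < 3) (by linarith : 1 - δ < 1)
      rwa [Real.rpow_one] at this
    have hcont : ContinuousAt (fun e : ℝ => (3 + e) ^ (1 - δ)) 0 :=
      ((continuous_const.add continuous_id).continuousAt).rpow_const (Or.inr hd')
    have hev : ∀ᶠ e in 𝓝 (0 : ℝ), (3 + e) ^ (1 - δ) < 3 := by
      have : (fun e : ℝ => (3 + e) ^ (1 - δ)) 0 < 3 := by simpa using h30
      exact hcont.eventually (gt_mem_nhds this)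
    obtain ⟨ε₀, hε₀, hball⟩ := Metric.eventually_nhds_iff.1 hev
    set ε : ℝ := ε₀ / 2 with hε
    have hε_pos : 0 < ε := by positivity
    have hlt : (3 + ε) ^ (1 - δ) < 3 := by
      apply hball
      rw [Real.dist_eq, sub_zero, abs_of_pos hε_pos, hε]
      linarith
    obtain ⟨N, B, _, _, _, f, a, hN, hexp, hdes, hcard⟩ := h ε hε_pos
    have h1 := hmain N B f a hexp hdes
    have h3ε : (0 : ℝ) ≤ 3 + ε := by positivity
    have h2 : (Fintype.card B : ℝ) ^ (1 - δ) ≤ ((3 + ε) ^ (1 - δ)) ^ N := by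
      rw [Real.rpow_pow_comm h3ε]
      exact Real.rpow_le_rpow (by positivity) hcard hd'
    have h3 : ((3 + ε) ^ (1 - δ)) ^ N < (3 : ℝ) ^ N :=
      pow_lt_pow_left₀ hlt (by positivity) hN.ne'
    linarith
  · -- δ > 1: |B|^{1-δ} ≤ 1 < 3 ≤ 3^N
    push Not at hd
    obtain ⟨N, B, _, _, _, f, a, hN, hexp, hdes, -⟩ := h 1 one_pos
    have h1 := hmain N B f a hexp hdes
    have hcard1 : (1 : ℝ) ≤ Fintype.card B := by exact_mod_cast Fintype.card_pos (α := B)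
    have h2 : (Fintype.card B : ℝ) ^ (1 - δ) ≤ 1 :=
      Real.rpow_le_one_of_one_le_of_nonpos hcard1 (by linarith)
    have h3 : (3 : ℝ) ≤ 3 ^ N := by
      calc (3 : ℝ) = 3 ^ 1 := (pow_one _).symm
        _ ≤ 3 ^ N := pow_le_pow_right₀ (by norm_num) hN
    linarith

end Main

end Summit.MatrixMultiplication.MatrixMultiplication.Theorems
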